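import Summits.ResolutionOfSingularities.ResolutionOfSingularities.Theorems.EquisingularLiftEquisingularLiftNatHyperplaneLetter
import HarnessLib

/-!
# [OURS · L1 W4.5(b) · EL♮(3) · door ν4, brick N-0 (JINIT at `RD := RPlus`), piece (N0-a′)] THE HOST'S ZERO SET IS CUT BY THE NORMALISED KERNEL
# GENERATOR — ★ `HostNormalForm.setOf_mem_eq_setOf_mem_linear`: `V₊(ℓ) = V₊(λ)` as point sets of `ℙ_k`

res-L1-w45b-nose-w1 g4 (WIDTH seat D-0157 DOOR 1).  DEF-FREE; no `sorry`; standard axioms.  `--supports stmt-ResolutionOfSingularities-20148 --as helper`,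
counted 0.

WHAT.  The door ν4 hands brick N-0 an ARBITRARY polynomial `ℓ` with host `E₀ = V₊(ℓ) := {y | ℓ ∈ 𝔭_y}` (all points of `Proj k[x]`, not only closed
ones), the engine's guarantee `V₊(ℓ) = V₊(ℓ₀)` for SOME non-zero linear `ℓ₀` (Level A v2's `hND` binders, ✓ `jinit_rPlus₀_of_noseDatum₂`), and — from
`EqCertAt₀` via ✓ `HyperplaneLift.exists_hyperplane_lift` — the NORMALISED linear generator `λ = Σ_i c_i x_i` (`c_a = 1`) of `ker (x ↦ B·y)` with `λ ∣ ℓ`.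
THEN `V₊(ℓ) = V₊(λ)`:  `⊇` since `λ ∣ ℓ`;  `⊆`: the point `η = (λ)` of `ℙ_k` (image of the generic point of `ℙ^{r}_k` under res-type-027's kill
substitution `f_k`, `ker f_k = (λ)` — ✓ `LinearLetter.exists_subst` / ✓ `ker_eq_span_sum`, pattern of ✓ `support_ker_eq_setOf_mem`) lies in
`V₊(λ) ⊆ V₊(ℓ) = V₊(ℓ₀)`, so `ℓ₀ ∈ (λ)`, hence `ℓ₀ = u·λ` with `u ∈ kˣ` (degrees) and the two hyperplanes coincide.  This identifies the host letter
built from `λ̃` (027's ✓ `TCPlus.letterDatum_hyperplane`, trace `𝓘⟨closure V₊(θλ̃)⟩`) with the door's `E₀ = V₊(ℓ)`.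
EL♮(3) is NOT proved; resolution of singularities in positive characteristic is NOT proved.
-/

set_option linter.dupNamespace false -- mandated namespace `Summit.<Summit>.<Problem>` of this single-conjunct summit

noncomputable section

open CategoryTheory AlgebraicGeometry MvPolynomial HomogeneousLocalization

namespace Summit.ResolutionOfSingularities.ResolutionOfSingularities.Cruxes.EquisingularLiftNat.Sections.Equinodal.HostNormalForm

variable {k : Type} [Field k] {r : ℕ}

/-- **The point `(λ)` of `ℙ_k`** for a linear form `λ = Σ_i c_i x_i` with `c_a = 1`: a point `η` whose homogeneous prime is EXACTLY `(λ)` (the image of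
the generic point of `ℙ^r_k` under res-type-027's kill substitution). [folklore; Hartshorne II Ex. 3.12 (a)] -/
theorem exists_point_asHomogeneousIdeal_eq_span (c : Fin (r + 1 + 1) → k) (a : Fin (r + 1 + 1)) (hc : c a = 1) :
    letI := MvPolynomial.gradedAlgebra (σ := Fin (r + 1 + 1)) (R := k)
    ∃ η : Proj (homogeneousSubmodule (Fin (r + 1 + 1)) k), η.asHomogeneousIdeal.toIdeal = Ideal.span {∑ i, C (c i) * X i} := by
  classical
  letI := MvPolynomial.gradedAlgebra (σ := Fin (r + 1 + 1)) (R := k)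
  letI := MvPolynomial.gradedAlgebra (σ := Fin (r + 1)) (R := k)
  -- the kill substitution `x_a ↦ −Σ_j c_{a.succAbove j} y_j`, `x_{a.succAbove j} ↦ y_j`
  let v : Fin (r + 1 + 1) → MvPolynomial (Fin (r + 1)) k :=
    Fin.insertNth a (C (-1) * ∑ j : Fin (r + 1), C (c (Fin.succAbove a j)) * X j) fun j => X j
  have hve : ∀ j, v (Fin.succAbove a j) = X j := fun j => by simp [v]
  have hva : v a = C (-1) * ∑ j : Fin (r + 1), C (c (Fin.succAbove a j)) * X j := by simp [v]
  have hv1 : ∀ i : Fin (r + 1 + 1), i ∉ Set.range (Fin.succAbove a) → (v i).IsHomogeneous 1 := by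
    intro i hi
    have hia : i = a := by
      have h : i ∈ (Set.range (Fin.succAbove a))ᶜ := hi
      rw [LinearLetter.compl_range_succAbove] at h
      exact h
    rw [hia, hva]
    exact LinearLetter.isHomogeneous_linVal_one a c 1
  obtain ⟨fk, hfk', hfkC, hfke, hfkv⟩ := LinearLetter.exists_subst (R := k) (Fin.succAbove a) v hve hv1
  have hvak : fk.toRingHom (X a) = C (-(1 : k)) * ∑ j : Fin (r + 1), C (c (Fin.succAbove a j)) * X j := by
    change fk (X a) = _; rw [hfkv, hva]
  have hker : RingHom.ker fk = Ideal.span {∑ i, C (c i) * X i} :=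
    LinearLetter.ker_eq_span_sum a fk.toRingHom c 1 (by rw [hc, one_mul]) hvak (fun b => hfkC b) (fun j => hfke j)
  -- the generic point of `ℙ^r_k` and its image
  let η₀ : Proj (homogeneousSubmodule (Fin (r + 1)) k) :=
    Literature.AlgebraicGeometry.Motives.coordSubspacePoint (k := k) (N := r) ∅ Finset.univ_nonempty.ne_empty.symm
  refine ⟨Proj.map fk hfk' η₀, ?_⟩
  rw [EquisingularLiftNat.LinearCentre.projMap_apply_asHomogeneousIdeal]
  ext G
  change G ∈ (ProjectiveSpectrum.asHomogeneousIdeal η₀).toIdeal.comap fk ↔ _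
  rw [Ideal.mem_comap, Literature.AlgebraicGeometry.Motives.toIdeal_coordSubspacePoint, Finset.coe_empty, Set.image_empty,
    Ideal.span_empty, Ideal.mem_bot, ← RingHom.mem_ker, hker]

/-- A non-zero homogeneous linear form divisible by another linear form is a UNIT multiple of it. [folklore] -/
theorem exists_C_mul_eq_of_dvd {σ : Type*} {L ℓ₀ : MvPolynomial σ k} (hL : L.IsHomogeneous 1) (hℓ₀ : ℓ₀.IsHomogeneous 1) (hℓ₀0 : ℓ₀ ≠ 0)
    (hdvd : L ∣ ℓ₀) : ∃ u : k, u ≠ 0 ∧ ℓ₀ = C u * L := by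
  obtain ⟨q, hq⟩ := hdvd
  have hL0 : L ≠ 0 := fun h => hℓ₀0 (by rw [hq, h, zero_mul])
  have hq0 : q ≠ 0 := fun h => hℓ₀0 (by rw [hq, h, mul_zero])
  have hdeg := totalDegree_mul_of_isDomain hL0 hq0
  rw [← hq, hℓ₀.totalDegree hℓ₀0, hL.totalDegree hL0] at hdeg
  have hqd : q.totalDegree = 0 := by omega
  obtain ⟨u, hu⟩ : ∃ u : k, q = C u := ⟨coeff 0 q, totalDegree_eq_zero_iff_eq_C.mp hqd⟩
  refine ⟨u, fun h => hq0 (by rw [hu, h, C_0]), ?_⟩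
  rw [hq, hu, mul_comm]

/-- ★ **`V₊(ℓ) = V₊(λ)` FOR THE NORMALISED KERNEL GENERATOR.**  `λ = Σ_i c_i x_i` with `c_a = 1` and `λ ∣ ℓ`; `ℓ₀` linear, non-zero, with
`V₊(ℓ) = V₊(ℓ₀)` (all points of `Proj k[x]`).  Then `{y | ℓ ∈ 𝔭_y} = {y | λ ∈ 𝔭_y}` — the door's host `E₀` IS the hyperplane of `λ`.
[OURS · brick N-0 piece (N0-a′); folklore] -/
theorem setOf_mem_eq_setOf_mem_linear (c : Fin (r + 1 + 1) → k) (a : Fin (r + 1 + 1)) (hc : c a = 1)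
    (ℓ : MvPolynomial (Fin (r + 1 + 1)) k) (hdvd : (∑ i, C (c i) * X i : MvPolynomial (Fin (r + 1 + 1)) k) ∣ ℓ)
    (ℓ₀ : MvPolynomial (Fin (r + 1 + 1)) k) (hℓ₀1 : ℓ₀.IsHomogeneous 1) (hℓ₀0 : ℓ₀ ≠ 0) :
    letI := MvPolynomial.gradedAlgebra (σ := Fin (r + 1 + 1)) (R := k)
    {y : Proj (homogeneousSubmodule (Fin (r + 1 + 1)) k) | ℓ ∈ y.asHomogeneousIdeal} =
      {y : Proj (homogeneousSubmodule (Fin (r + 1 + 1)) k) | ℓ₀ ∈ y.asHomogeneousIdeal} →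
    {y : Proj (homogeneousSubmodule (Fin (r + 1 + 1)) k) | ℓ ∈ y.asHomogeneousIdeal} =
      {y : Proj (homogeneousSubmodule (Fin (r + 1 + 1)) k) | (∑ i, C (c i) * X i : MvPolynomial (Fin (r + 1 + 1)) k) ∈ y.asHomogeneousIdeal} := by
  classical
  letI := MvPolynomial.gradedAlgebra (σ := Fin (r + 1 + 1)) (R := k)
  intro hV
  set L : MvPolynomial (Fin (r + 1 + 1)) k := ∑ i, C (c i) * X i with hLdef
  have hL1 : L.IsHomogeneous 1 := LinearLetter.isHomogeneous_sum_C_mul_X_one c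
  -- `⊇`: `λ ∣ ℓ`
  have hsup : ∀ y : Proj (homogeneousSubmodule (Fin (r + 1 + 1)) k), L ∈ y.asHomogeneousIdeal → ℓ ∈ y.asHomogeneousIdeal := by
    intro y hy
    obtain ⟨m, hm⟩ := hdvd
    have : ℓ ∈ (ProjectiveSpectrum.asHomogeneousIdeal y).toIdeal := by
      rw [hm]; exact Ideal.mul_mem_right _ _ hy
    exact this
  -- the point `(λ)` lies in `V₊(ℓ) = V₊(ℓ₀)`, so `λ ∣ ℓ₀`, so `ℓ₀ = u·λ`
  obtain ⟨η, hη⟩ := exists_point_asHomogeneousIdeal_eq_span c a hc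
  have hLη : L ∈ η.asHomogeneousIdeal := by
    change L ∈ (ProjectiveSpectrum.asHomogeneousIdeal η).toIdeal
    rw [hη]; exact Ideal.mem_span_singleton_self L
  have hℓ₀η : ℓ₀ ∈ η.asHomogeneousIdeal := by
    have h : η ∈ {y : Proj (homogeneousSubmodule (Fin (r + 1 + 1)) k) | ℓ ∈ y.asHomogeneousIdeal} := hsup η hLη
    rw [hV] at h
    exact h
  have hdvd₀ : L ∣ ℓ₀ := by
    have h : ℓ₀ ∈ (ProjectiveSpectrum.asHomogeneousIdeal η).toIdeal := hℓ₀η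
    rw [hη] at h
    exact Ideal.mem_span_singleton.mp h
  obtain ⟨u, hu0, hu⟩ := exists_C_mul_eq_of_dvd hL1 hℓ₀1 hℓ₀0 hdvd₀
  -- conclude
  ext y
  simp only [Set.mem_setOf_eq]
  constructor
  · intro hy
    have hy₀ : ℓ₀ ∈ y.asHomogeneousIdeal := by
      have h : y ∈ {y : Proj (homogeneousSubmodule (Fin (r + 1 + 1)) k) | ℓ ∈ y.asHomogeneousIdeal} := hy
      rw [hV] at h
      exact h
    have : C u⁻¹ * ℓ₀ ∈ (ProjectiveSpectrum.asHomogeneousIdeal y).toIdeal := Ideal.mul_mem_left _ _ hy₀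
    rw [hu, ← mul_assoc, ← C_mul, inv_mul_cancel₀ hu0, C_1, one_mul] at this
    exact this
  · exact hsup y

end Summit.ResolutionOfSingularities.ResolutionOfSingularities.Cruxes.EquisingularLiftNat.Sections.Equinodal.HostNormalForm

end
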